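import Summits.AtomisticToContinuum.FouriersLaw.Theses.EmbeddedDrudeMourre
import Summits.AtomisticToContinuum.FouriersLaw.Theses.KineticCorner
import Summits.AtomisticToContinuum.FouriersLaw.Theorems.EmbeddedDrudeMourreAbelOfSpectralDensity
import Summits.AtomisticToContinuum.FouriersLaw.Theorems.EmbeddedDrudeMourreMourreDissolutionOfKineticCorner
import Summits.AtomisticToContinuum.FouriersLaw.Theorems.EmbeddedDrudeMourreDrudeDissolutionStubBmRigidity
import Summits.AtomisticToContinuum.FouriersLaw.Theorems.EmbeddedDrudeMourreDrudeDissolutionOfBmKineticCruxes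
import Summits.AtomisticToContinuum.FouriersLaw.Theorems.KineticCornerStationaryCorrelationBound
import Summits.AtomisticToContinuum.FouriersLaw.Theorems.DrudeDissolution.Negative.WeakAnharmonicityForm
import Summits.AtomisticToContinuum.FouriersLaw.Theorems.DrudeDissolution.Negative.SpectralPairNecessities

/-!
# Line `natural-scale-poisson-sandwich` — skeleton for crux `EmbeddedDrudeMourre.DrudeDissolution`
(stmt-AtomisticToContinuum-12593; route `route-AtomisticToContinuum-EmbeddedDrudeMourre`, sub `FouriersLaw`)

Crux-plan of idea `Cruxes/DrudeDissolution/Ideas/natural-scale-poisson-sandwich.md` (triage r1-1/r1-2/r1-3: pass ×3),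
planner `planner-cruxplan-stmt-AtomisticToContinuum-12593-natural-scale-poisso-0`, 2026-08-16.

## The cut

Crux (FIXED, concluded BY NAME below): `∀ ω₂ lam β γ > 0 ∃ T₀ > 0 ∀ T ∈ (0,T₀) ∃ μ_T D`, DLR at `T`, `D` preserving
`μ_T` with absolutely convergent summed current correlations `C_T`, `∃ σ` finite with `C_T(t) = ∫ cos(ωt) dσ(ω)`, and a
window `(−δ, δ)` on which `σ = g dω`, `g` continuous `≥ 0`, `g 0 > 0`.

NATURAL SCALE. By the scaling conjugacy (Disproof §3d; landed `Negative.drudeDissolution_iff_weak_anharmonicity`,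
`exists_witness_iff_unit_temp`, p82638) temperature `T` at couplings `(lam, β)` is unit temperature at couplings
`(lamT, βT)`; the kinetic time is `T⁻²` (original time units), the expected linewidth of the dissolved Drude atom is
`Γ_T ≍ T²`, its height `g_T(0) ≍ 1` (`T`-independent), the total spectral mass `σ_T(ℝ) = C_T(0) = O(T²)`
(`StationaryCorrelationBound`, stmt-3435, PROVED). Everything below is written in the ORIGINAL variables at that scale:
window `(−c₀T², c₀T²)`, inner window `(−cT², cT²)`, Abel parameter `ν·T²`.

POISSON SANDWICH (pure analysis, PROVED here from the landed Poisson-kernel lemmas of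
`Theorems/EmbeddedDrudeMourreAbelOfSpectralDensity.lean`, stmt-12598): for `ν' > 0`, a window `(−δ, δ)` with density
`0 ≤ g ≤ M'`, an inner window `(−ρ, ρ)` with `g ≤ M` there,
  `∫₀^∞ e^{−ν't} C(t) dt = ∫ ν'/(ν'²+ω²) dσ(ω) ≤ π·M + 2δ(ν'/ρ²)·M' + (ν'/δ²)·σ(ℝ)`        (`abelMean_le_of_window`).
With `δ = c₀T²`, `ρ = cT²`, `ν' = νT²`, `M = g(0) + m(c)`, `M' = K`, `σ(ℝ) = C_T(0) ≤ B T²` (`Negative.cosine_zero` + the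
PROVED `StationaryCorrelationBound`, stmt-3435) every term is `T`-INDEPENDENT:
  `a₀ ≤ A_T(νT²) ≤ π g_T(0) + π m(c) + 2c₀Kν/c² + Bν/c₀²`,
so `g_T(0) ≥ a₀/(4π) > 0` after choosing `c` (with `π m(c) ≤ a₀/4`), then `ν` (the two `ν`-terms `≤ a₀/4` each), then `T`
(`spectralWitnesses_of_sandwich`, the `quarter_budget` of the card, PROVED). Hence the crux splits into

* F  `stub_windowModulusAtScale` — FREQUENCY SIDE (research-open; HARDEST): for `T < T₀` some Buttà–Marchioro-class pair
     `(μ, D)` (DLR at `T`, unit-shift invariant, `D.carrier = bmGood`, `D` preserves `μ` — by the landed RIGIDITY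
     `LineSketch.stub_bmRigidity`, p127446, its `C_T` is THE canonical summed current autocorrelation) has a representing
     finite measure `σ` (`C_T = ∫cos dσ`; `σ(ℝ) = C_T(0) ≤ BT²` is automatic) with, on the window `(−c₀T², c₀T²)`, a continuous density
     `0 ≤ g ≤ K` whose modulus of continuity AT THE ORIGIN AT SCALE `T²` is `T`-uniform: `|g(ω) − g(0)| ≤ m(c)` for
     `|ω| < cT²`, `c ≤ c₀`, with `m(c) → 0` as `c ↓ 0`. NO positivity of `g(0)`, no value, no identification or inversion of
     a level-shift operator: the generic output of a limiting-absorption principle at frequency `0` whose commutator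
     constant is `≍ T²` (the effective anharmonicity squared).
* T  `stub_kineticAbelFloor` — TIME SIDE (research-open in `d = 1`, but FINITE kinetic windows only): `∃ a₀, ν₀ > 0` such
     that for every `ν ∈ (0, ν₀]`, eventually as `T ↓ 0`, some BM-class pair has `∫₀^∞ e^{−νT²t} C_T(t) dt ≥ a₀` — the
     summed current survives, in `νT²`-Abel mean, i.e. on `O(ν⁻¹)` KINETIC TIMES; the tail beyond is trivial
     (`|C_T| ≤ B T²`). It is the finite-window wave-kinetic limit of route KineticCorner (`KineticLimit`, stmt-3431) in Abel
     form and strictly weaker: `kineticAbelFloor_of_kineticLimit` below derives T from stmt-3431 (PROVED implication) through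
* B  `abelFloor_of_windowLimits` — ABEL SUMMATION OF WINDOW LIMITS (pure real analysis; the registered stub
     `stub_abelFloor_of_windowLimits` of skeleton v1, PROVED in v2, ~400 lines incl. helpers): a family `t ↦ C_T(t)`
     with `|C_T| ≤ B T²` whose integrals over every kinetic window `[δT⁻², MT⁻²]` converge to `∫_δ^M K` (`K ∈ L¹`,
     `∫₀^∞ K > 0`) has the Abel floor of T (integration by parts on the window + substitution `s = T²t`, dominated
     convergence in `s`, head `≤ Bδ`, tail `≤ B e^{−νM}/ν`, `e^{−νS} ≥ 1 − νS`). Hence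
     `kineticAbelFloor_of_kineticLimit : KineticCorner.KineticLimit → T` is PROVED (sorry-free): landing stmt-3431
     closes T.
So the REGISTERED STUBS of v2 are exactly the two halves F and T.

`DrudeDissolution_of : DrudeDissolution` (the ONLY theorem of this file headed by the crux decl) = the sandwich applied to
F and T at the canonical datum (`MourreDissolution.canonicalDatum`, p121356) through rigidity. Neither side alone gives the
crux: at the harmonic endpoint the floor T holds (Drude atom ⇒ `A = D/ν → ∞`) and F fails (Disproof §4,
`Negative.not_window_of_conserved`); with a spectral pseudogap F holds with `g ≡ 0` near `0` and T fails.

## Disproof used (`Cruxes/DrudeDissolution/Disproof.lean`, cdisprove cycle 1, RESISTS; read 2026-08-16T23:10Z,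
mtime 06:13Z; no `-- Targets`, no `stub_*_false`, one negative-side `sorry` = `harmonic_no_spectralWitness`)
§3d normal form (scale `T²`; the line is its original-variable reading); §3a `drudeDissolution_false_without_temp_pos`
(H = `0 < T`: every stub quantifies `0 < T`, used at `canonicalDatum … T hT`); §3c junk witnesses — excluded structurally
(BM carrier + DLR clause; `exists_laxWitness` needs `g = 0`, which T forbids through the sandwich); §2 `abs_cosine_le`,
`cosine_zero` (`σ(ℝ) = C(0)`: USED in the composition with stmt-3435 for the outside term); §5 `exists_window_not_integrable` — respected:
no `C_T ∈ L¹` is claimed anywhere (T is an Abel mean at FIXED `ν > 0`, F a window statement); §4 endpoint behaves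
correctly (above). Landed Negative lemmas imported: `Negative.WeakAnharmonicityForm`, `Negative.SpectralPairNecessities`.
-/

noncomputable section

open MeasureTheory Filter Set Function
open scoped Topology ENNReal

namespace Summit.AtomisticToContinuum.FouriersLaw.Cruxes.DrudeDissolution.NaturalScalePoissonSandwich

open Literature.MathematicalPhysics.KineticTheory.HeatConduction

/-! ## Registered stubs (`sorry` only here; every signature self-contained over tree declarations) -/

/-- **F `stub_windowModulusAtScale` — WINDOW DENSITY WITH A `T`-UNIFORM MODULUS AT THE NATURAL SCALE `T²`**
(frequency side; research-open; the HARDEST stub). For `pinnedChain ω₂ lam β γ` (all `> 0`) there are `c₀, K, T₀ > 0` and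
a modulus `m` with `m(c) → 0` as `c ↓ 0` such that for every `T ∈ (0, T₀)` SOME Buttà–Marchioro-class pair `(μ, D)` — `μ` DLR
at `T` and invariant under the unit shift, `D.carrier = bmGood`, `D` preserving `μ` (so `C_T := D.currentCorrelation μ` is the
canonical summed current autocorrelation, `LineSketch.stub_bmRigidity`) — admits a finite measure `σ` on `ℝ` with
`C_T(t) = ∫ cos(ωt) dσ(ω)` for all `t` (its mass `σ(ℝ) = C_T(0) ≤ B T²` is then automatic: `Negative.cosine_zero` +
`StationaryCorrelationBound`, used in the composition, not asked here), and on the window `(−c₀T², c₀T²)` a continuous density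
`g` with `0 ≤ g ≤ K` and `|g(ω) − g(0)| ≤ m(c)` whenever `|ω| < cT²`, `0 < c ≤ c₀`. Informal content: a limiting-absorption
principle at frequency `0` for the Liouvillean of the Gibbs state on the zero-wavenumber current sector, with Mourre constant
`≍ (lamT, βT)²` and boundary values continuous at `0` UNIFORMLY at that scale (unit-temperature reading: density `≤ K/ε²`,
window `c₀ε²`, modulus `m(c)/ε²` on `|ω| < cε²`). What it does NOT contain: `g(0) > 0`, the value of `g(0)`, any Feshbach
identification/inversion of the level-shift form, any decay of `C_T`. Fed by any LAP line of the sibling crux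
`MourreDissolution` (stmt-12594) stated with its constants. [cite: AokiLukkarinenSpohn2006 §3; CattaneoGrafHunziker2006;
JaksicPillet1996; Merkli2001; book:amrein1996-c0-groups-commutator-methods-spectral-theory-n Thm 7.4.1] -/
theorem stub_windowModulusAtScale :
    ∀ ω₂ lam β γ : ℝ, 0 < ω₂ → 0 < lam → 0 < β → 0 < γ →
      ∃ (c₀ K T₀ : ℝ) (m : ℝ → ℝ), 0 < c₀ ∧ 0 < K ∧ 0 < T₀ ∧
        Filter.Tendsto m (nhdsWithin 0 (Set.Ioi 0)) (nhds 0) ∧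
        ∀ T : ℝ, 0 < T → T < T₀ →
          ∃ (μ : MeasureTheory.Measure Literature.MathematicalPhysics.KineticTheory.HeatConduction.ChainConfig)
            (D : Literature.MathematicalPhysics.KineticTheory.HeatConduction.InfiniteChainDynamics
              (Literature.MathematicalPhysics.KineticTheory.HeatConduction.pinnedChain ω₂ lam β γ)),
            (Literature.MathematicalPhysics.KineticTheory.HeatConduction.pinnedChain ω₂ lam β γ).IsChainGibbsMeasure T μ ∧
            MeasureTheory.MeasurePreserving
              (fun σ : Literature.MathematicalPhysics.KineticTheory.HeatConduction.ChainConfig => fun i : ℤ => σ (i + 1)) μ μ ∧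
            D.carrier = (Literature.MathematicalPhysics.KineticTheory.HeatConduction.pinnedChain ω₂ lam β γ).bmGood ∧
            D.PreservesMeasure μ ∧
            ∃ σ : MeasureTheory.Measure ℝ, MeasureTheory.IsFiniteMeasure σ ∧
              (∀ t : ℝ, D.currentCorrelation μ t = ∫ ω, Real.cos (ω * t) ∂σ) ∧
              ∃ g : ℝ → ℝ, ContinuousOn g (Set.Ioo (-(c₀ * T ^ 2)) (c₀ * T ^ 2)) ∧
                (∀ ω ∈ Set.Ioo (-(c₀ * T ^ 2)) (c₀ * T ^ 2), 0 ≤ g ω) ∧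
                (∀ ω ∈ Set.Ioo (-(c₀ * T ^ 2)) (c₀ * T ^ 2), g ω ≤ K) ∧
                (∀ c : ℝ, 0 < c → c ≤ c₀ → ∀ ω ∈ Set.Ioo (-(c * T ^ 2)) (c * T ^ 2), |g ω - g 0| ≤ m c) ∧
                σ.restrict (Set.Ioo (-(c₀ * T ^ 2)) (c₀ * T ^ 2)) =
                  (MeasureTheory.volume.restrict (Set.Ioo (-(c₀ * T ^ 2)) (c₀ * T ^ 2))).withDensity
                    fun ω => ENNReal.ofReal (g ω) := by
  sorry

/-- **T `stub_kineticAbelFloor` — THE CURRENT SURVIVES ON KINETIC TIMES, IN ABEL MEAN** (time side; research-open in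
`d = 1` but a FINITE-WINDOW statement). For `pinnedChain ω₂ lam β γ` (all `> 0`) there are `a₀, ν₀ > 0` such that for every
`ν ∈ (0, ν₀]` there is `T₀ > 0` with: for every `T ∈ (0, T₀)` SOME Buttà–Marchioro-class pair `(μ, D)` (as in F; canonical
`C_T` by rigidity) has `∫₀^∞ e^{−νT²t} C_T(t) dt ≥ a₀`. Units: `t = τT⁻²`, so this is `∫₀^∞ e^{−ντ} [T⁻²C_T(τT⁻²)] dτ ≥ a₀`:
kinetic theory predicts `T⁻²C_T(τT⁻²) → K(τ) = ⟨v, e^{−τL}v⟩` (ALS06 (3.22); `L` the linearised phonon Boltzmann operator of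
the pinned band) and the floor with `a₀ ≈ ½∫₀^∞K`; the weight `e^{−ντ}` makes every time beyond `M(ν)` kinetic times
irrelevant (`|C_T| ≤ B T²`, stmt-3435), so NO post-kinetic tail (stmt-3430) and no `L¹` enter. Holds (uselessly) at the
harmonic point, where the Drude atom gives `A = D/ν`: not a costume of the crux. Derived below from route KineticCorner's
`KineticLimit` (stmt-3431) via B (`kineticAbelFloor_of_kineticLimit`). [cite: AokiLukkarinenSpohn2006 §3 (3.20)–(3.23);
LukkarinenSpohn2010 Thm 2.4; BonettoLebowitzReyBellet2000 §6.3 (35)] -/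
theorem stub_kineticAbelFloor :
    ∀ ω₂ lam β γ : ℝ, 0 < ω₂ → 0 < lam → 0 < β → 0 < γ →
      ∃ a₀ ν₀ : ℝ, 0 < a₀ ∧ 0 < ν₀ ∧ ∀ ν : ℝ, 0 < ν → ν ≤ ν₀ →
        ∃ T₀ : ℝ, 0 < T₀ ∧ ∀ T : ℝ, 0 < T → T < T₀ →
          ∃ (μ : MeasureTheory.Measure Literature.MathematicalPhysics.KineticTheory.HeatConduction.ChainConfig)
            (D : Literature.MathematicalPhysics.KineticTheory.HeatConduction.InfiniteChainDynamics
              (Literature.MathematicalPhysics.KineticTheory.HeatConduction.pinnedChain ω₂ lam β γ)),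
            (Literature.MathematicalPhysics.KineticTheory.HeatConduction.pinnedChain ω₂ lam β γ).IsChainGibbsMeasure T μ ∧
            MeasureTheory.MeasurePreserving
              (fun σ : Literature.MathematicalPhysics.KineticTheory.HeatConduction.ChainConfig => fun i : ℤ => σ (i + 1)) μ μ ∧
            D.carrier = (Literature.MathematicalPhysics.KineticTheory.HeatConduction.pinnedChain ω₂ lam β γ).bmGood ∧
            D.PreservesMeasure μ ∧
            a₀ ≤ ∫ t in Set.Ioi (0 : ℝ), Real.exp (-(ν * T ^ 2 * t)) * D.currentCorrelation μ t := by
  sorry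

/-! ## The Poisson sandwich (pure analysis, PROVED) -/

/-- **Poisson sandwich, upper half.** For a finite measure `σ` on `ℝ` which on the window `(−δ, δ)` is Lebesgue measure
with a continuous density `g`, `0 ≤ g ≤ M'` there and `g ≤ M` on the inner window `(−ρ, ρ)` (`ρ > 0`; only `ρ ≤ δ` is
useful), `0 ≤ M, M'`, and `ν > 0`: `∫ ν/(ν²+ω²) dσ(ω) ≤ π·M + 2δ·(ν/ρ²)·M' + (ν/δ²)·σ(ℝ)` (inner window: Poisson mass
`≤ π`; annulus: `ν/(ν²+ω²) ≤ ν/ρ²` on a set of Lebesgue measure `≤ 2δ`; outside: `≤ ν/δ²`). The matching lower bound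
`m·2arctan(ρ/ν) ≤ ∫ ν/(ν²+ω²) dσ` (`g ≥ m` on the inner window) is not needed by the line. [folklore] -/
theorem abelMean_le_of_window (σ : Measure ℝ) [IsFiniteMeasure σ] {δ ρ ν M M' : ℝ}
    (hδ : 0 < δ) (hρ : 0 < ρ) (hν : 0 < ν) (hM : 0 ≤ M) (hM' : 0 ≤ M')
    {g : ℝ → ℝ} (hgc : ContinuousOn g (Ioo (-δ) δ)) (hg0 : ∀ ω ∈ Ioo (-δ) δ, 0 ≤ g ω)
    (hgM' : ∀ ω ∈ Ioo (-δ) δ, g ω ≤ M') (hgM : ∀ ω ∈ Ioo (-ρ) ρ, g ω ≤ M)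
    (hσ : σ.restrict (Ioo (-δ) δ) = (volume.restrict (Ioo (-δ) δ)).withDensity fun ω => ENNReal.ofReal (g ω)) :
    ∫ ω, ν / (ν ^ 2 + ω ^ 2) ∂σ ≤ Real.pi * M + 2 * δ * (ν / ρ ^ 2) * M' + ν / δ ^ 2 * σ.real univ := by
  set P : ℝ → ℝ := fun ω => ν / (ν ^ 2 + ω ^ 2) with hP
  obtain ⟨hPint, hPtot⟩ := Theorems.AbelOfSpectralDensity.integrable_poisson_and_integral_eq_pi hν
  have hPpos : ∀ ω, 0 ≤ P ω := fun ω => by positivity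
  have hPc : Continuous P := by
    refine continuous_const.div (by fun_prop) (fun ω => ?_)
    positivity
  have hPle : ∀ ω, P ω ≤ 1 / ν := fun ω => by
    simp only [hP]
    rw [div_le_div_iff₀ (by positivity) hν, one_mul]
    nlinarith [sq_nonneg ω]
  -- `P` is `σ`-integrable
  have hPσ : Integrable P σ := by
    refine (integrable_const (1 / ν)).mono' hPc.aestronglyMeasurable (ae_of_all _ (fun ω => ?_))
    rw [Real.norm_eq_abs, abs_of_nonneg (hPpos ω)]
    exact hPle ω
  -- the density on the window
  have hgm : AEMeasurable g (volume.restrict (Ioo (-δ) δ)) :=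
    (hgc.aestronglyMeasurable measurableSet_Ioo).aemeasurable
  have hgi : IntegrableOn g (Ioo (-δ) δ) :=
    Theorems.AbelOfSpectralDensity.integrableOn_of_restrict_eq_withDensity hgc hg0 hσ
  have hS : volume (Ioo (-δ) δ) ≠ ∞ := by
    rw [Real.volume_Ioo]; exact ENNReal.ofReal_ne_top
  have hPg : IntegrableOn (fun ω => P ω * g ω) (Ioo (-δ) δ) :=
    Integrable.bdd_mul hgi hPc.aestronglyMeasurable (ae_of_all _ (fun ω => by
      rw [Real.norm_eq_abs, abs_of_nonneg (hPpos ω)]; exact hPle ω))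
  -- pointwise bound on the window: inner part by `M·P`, annulus by `(ν/ρ²)·M'`
  have hbound : ∀ ω ∈ Ioo (-δ) δ, P ω * g ω ≤ M * P ω + ν / ρ ^ 2 * M' := by
    intro ω hω
    have h2 : 0 ≤ ν / ρ ^ 2 * M' := by positivity
    have h3 : 0 ≤ M * P ω := mul_nonneg hM (hPpos ω)
    by_cases hin : ω ∈ Ioo (-ρ) ρ
    · have h1 : P ω * g ω ≤ P ω * M := mul_le_mul_of_nonneg_left (hgM ω hin) (hPpos ω)
      linarith [mul_comm (P ω) M]
    · have hρω : ρ ^ 2 ≤ ω ^ 2 := by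
        simp only [mem_Ioo, not_and_or, not_lt] at hin
        rcases hin with h | h
        · have h' : ρ ^ 2 ≤ (-ω) ^ 2 := pow_le_pow_left₀ hρ.le (by linarith) 2
          rw [neg_sq] at h'
          exact h'
        · exact pow_le_pow_left₀ hρ.le h 2
      have hω2 : 0 < ω ^ 2 := lt_of_lt_of_le (by positivity) hρω
      have hPω : P ω ≤ ν / ρ ^ 2 :=
        calc P ω ≤ ν / ω ^ 2 := div_le_div_of_nonneg_left hν.le hω2 (by nlinarith)
          _ ≤ ν / ρ ^ 2 := div_le_div_of_nonneg_left hν.le (by positivity) hρω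
      have h1 : P ω * g ω ≤ ν / ρ ^ 2 * M' := mul_le_mul hPω (hgM' ω hω) (hg0 ω hω) (by positivity)
      linarith
  -- the window part
  have hwin : ∫ ω in Ioo (-δ) δ, P ω * g ω ≤ Real.pi * M + 2 * δ * (ν / ρ ^ 2) * M' := by
    have hPM : IntegrableOn (fun ω => M * P ω) (Ioo (-δ) δ) := (hPint.const_mul M).integrableOn
    have hcst : IntegrableOn (fun _ : ℝ => ν / ρ ^ 2 * M') (Ioo (-δ) δ) := integrableOn_const hS
    have hrhs : IntegrableOn (fun ω => M * P ω + ν / ρ ^ 2 * M') (Ioo (-δ) δ) := hPM.add hcst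
    have hwinP : ∫ ω in Ioo (-δ) δ, P ω ≤ Real.pi :=
      calc ∫ ω in Ioo (-δ) δ, P ω ≤ ∫ ω, P ω := setIntegral_le_integral hPint (ae_of_all _ hPpos)
        _ = Real.pi := hPtot
    have hvol : (volume : Measure ℝ).real (Ioo (-δ) δ) = 2 * δ := by
      rw [Real.volume_real_Ioo_of_le (by linarith)]; ring
    calc ∫ ω in Ioo (-δ) δ, P ω * g ω ≤ ∫ ω in Ioo (-δ) δ, (M * P ω + ν / ρ ^ 2 * M') :=
          setIntegral_mono_on hPg hrhs measurableSet_Ioo hbound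
      _ = M * (∫ ω in Ioo (-δ) δ, P ω) + (volume : Measure ℝ).real (Ioo (-δ) δ) * (ν / ρ ^ 2 * M') := by
          rw [integral_add hPM hcst, integral_const_mul, setIntegral_const, smul_eq_mul]
      _ ≤ M * Real.pi + 2 * δ * (ν / ρ ^ 2 * M') := by
          rw [hvol]
          exact add_le_add (mul_le_mul_of_nonneg_left hwinP hM) le_rfl
      _ = Real.pi * M + 2 * δ * (ν / ρ ^ 2) * M' := by ring
  -- the part outside the window
  have hout : ∫ ω in (Ioo (-δ) δ)ᶜ, P ω ∂σ ≤ ν / δ ^ 2 * σ.real univ :=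
    (Real.le_norm_self _).trans (Theorems.AbelOfSpectralDensity.norm_setIntegral_poisson_compl_le σ hδ hν.le)
  -- assemble
  rw [← integral_add_compl (μ := σ) measurableSet_Ioo hPσ,
    Theorems.AbelOfSpectralDensity.setIntegral_eq_of_restrict_eq_withDensity hg0 hgm hσ P]
  linarith

/-! ## The quarter budget: F ∧ T at one parameter point ⇒ spectral witnesses (PROVED) -/

/-- **The sandwich composition at one parameter point.** If the frequency side F and the time side T hold for
`pinnedChain ω₂ lam β γ` (all `> 0`), then spectral witnesses exist for all small `T`: choose `c ≤ c₀` with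
`π m(c) ≤ a₀/4` (`m → 0`), then `ν ≤ ν₀` with `2c₀Kν/c² ≤ a₀/4` and `B⁺ν/c₀² ≤ a₀/4` (`B⁺ = max B 1`, `B` the constant of the
PROVED a-priori bound `|C_T| ≤ BT²`, `KineticCorner.stationaryCorrelationBound_proof`, stmt-3435), then
`T < min T₀ᶠ T₀ᵗ(ν) T₁ᵇ`; at such `T` the F-pair, the T-pair and the canonical datum (`MourreDissolution.canonicalDatum`) have the
same `C_T` by rigidity (`LineSketch.stub_bmRigidity`); `σ(ℝ) = C_T(0) ≤ BT²` (`Negative.cosine_zero`);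
`∫₀^∞e^{−νT²t}C_T = ∫ ν'/(ν'²+ω²)dσ` (`integral_exp_neg_mul_cosTransform`, `ν' = νT²`) and `abelMean_le_of_window` give
`a₀ ≤ π g(0) + 3a₀/4`, so `g(0) > 0`; the witness is the canonical datum with F's `σ, g` and `δ = c₀T²`. [folklore] -/
theorem spectralWitnesses_of_sandwich {ω₂ lam β γ : ℝ} (hω : 0 < ω₂) (hl : 0 < lam) (hβ : 0 < β) (hγ : 0 < γ)
    (hF : ∃ (c₀ K T₀ : ℝ) (m : ℝ → ℝ), 0 < c₀ ∧ 0 < K ∧ 0 < T₀ ∧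
        Filter.Tendsto m (nhdsWithin 0 (Set.Ioi 0)) (nhds 0) ∧
        ∀ T : ℝ, 0 < T → T < T₀ →
          ∃ (μ : Measure ChainConfig) (D : InfiniteChainDynamics (pinnedChain ω₂ lam β γ)),
            (pinnedChain ω₂ lam β γ).IsChainGibbsMeasure T μ ∧
            MeasurePreserving (fun σ : ChainConfig => fun i : ℤ => σ (i + 1)) μ μ ∧
            D.carrier = (pinnedChain ω₂ lam β γ).bmGood ∧
            D.PreservesMeasure μ ∧
            ∃ σ : Measure ℝ, IsFiniteMeasure σ ∧
              (∀ t : ℝ, D.currentCorrelation μ t = ∫ ω, Real.cos (ω * t) ∂σ) ∧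
              ∃ g : ℝ → ℝ, ContinuousOn g (Ioo (-(c₀ * T ^ 2)) (c₀ * T ^ 2)) ∧
                (∀ ω ∈ Ioo (-(c₀ * T ^ 2)) (c₀ * T ^ 2), 0 ≤ g ω) ∧
                (∀ ω ∈ Ioo (-(c₀ * T ^ 2)) (c₀ * T ^ 2), g ω ≤ K) ∧
                (∀ c : ℝ, 0 < c → c ≤ c₀ → ∀ ω ∈ Ioo (-(c * T ^ 2)) (c * T ^ 2), |g ω - g 0| ≤ m c) ∧
                σ.restrict (Ioo (-(c₀ * T ^ 2)) (c₀ * T ^ 2)) =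
                  (volume.restrict (Ioo (-(c₀ * T ^ 2)) (c₀ * T ^ 2))).withDensity fun ω => ENNReal.ofReal (g ω))
    (hT : ∃ a₀ ν₀ : ℝ, 0 < a₀ ∧ 0 < ν₀ ∧ ∀ ν : ℝ, 0 < ν → ν ≤ ν₀ →
        ∃ T₀ : ℝ, 0 < T₀ ∧ ∀ T : ℝ, 0 < T → T < T₀ →
          ∃ (μ : Measure ChainConfig) (D : InfiniteChainDynamics (pinnedChain ω₂ lam β γ)),
            (pinnedChain ω₂ lam β γ).IsChainGibbsMeasure T μ ∧
            MeasurePreserving (fun σ : ChainConfig => fun i : ℤ => σ (i + 1)) μ μ ∧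
            D.carrier = (pinnedChain ω₂ lam β γ).bmGood ∧
            D.PreservesMeasure μ ∧
            a₀ ≤ ∫ t in Ioi (0 : ℝ), Real.exp (-(ν * T ^ 2 * t)) * D.currentCorrelation μ t) :
    ∃ T₀ : ℝ, 0 < T₀ ∧ ∀ T : ℝ, 0 < T → T < T₀ →
      ∃ (μT : Measure ChainConfig) (D : InfiniteChainDynamics (pinnedChain ω₂ lam β γ)),
        (pinnedChain ω₂ lam β γ).IsChainGibbsMeasure T μT ∧ D.PreservesMeasure μT ∧
          (∀ t : ℝ, D.HasAbsConvergentCorrelation μT t) ∧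
            ∃ σ : Measure ℝ, IsFiniteMeasure σ ∧
              (∀ t : ℝ, D.currentCorrelation μT t = ∫ ω, Real.cos (ω * t) ∂σ) ∧
                ∃ (δ : ℝ) (g : ℝ → ℝ), 0 < δ ∧ ContinuousOn g (Ioo (-δ) δ) ∧
                  (∀ ω ∈ Ioo (-δ) δ, 0 ≤ g ω) ∧ 0 < g 0 ∧
                    σ.restrict (Ioo (-δ) δ) =
                      (volume.restrict (Ioo (-δ) δ)).withDensity fun ω => ENNReal.ofReal (g ω) := by
  obtain ⟨c₀, K, T₀F, m, hc₀, hK, hT₀F, hm, hFw⟩ := hF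
  obtain ⟨a₀, ν₀, ha₀, hν₀, hTw⟩ := hT
  -- the a-priori bound `|C_T| ≤ B T²` (stmt-3435, PROVED) controls the total spectral mass `σ(ℝ) = C_T(0)`
  obtain ⟨B, T₁b, hT₁b, hSCB⟩ := Theorems.KineticCorner.stationaryCorrelationBound_proof ω₂ lam β γ hω hl hβ hγ
  obtain ⟨Bp, hBp, hBBp⟩ : ∃ Bp : ℝ, 0 < Bp ∧ B ≤ Bp := ⟨max B 1, lt_max_of_lt_right one_pos, le_max_left _ _⟩
  -- Step 1: the inner scale `c ∈ (0, c₀]` with `π·m(c) ≤ a₀/4`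
  obtain ⟨c, hc, hcc₀, hmc⟩ : ∃ c : ℝ, 0 < c ∧ c ≤ c₀ ∧ Real.pi * m c ≤ a₀ / 4 := by
    have h1 : ∀ᶠ x in 𝓝[>] (0 : ℝ), m x < a₀ / (4 * Real.pi) := hm (Iio_mem_nhds (by positivity))
    have h2 : ∀ᶠ x in 𝓝[>] (0 : ℝ), x ∈ Ioo 0 c₀ := Ioo_mem_nhdsGT hc₀
    obtain ⟨c, hc1, hc2⟩ := (h1.and h2).exists
    refine ⟨c, hc2.1, hc2.2.le, ?_⟩
    have h3 : Real.pi * m c ≤ Real.pi * (a₀ / (4 * Real.pi)) :=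
      mul_le_mul_of_nonneg_left hc1.le Real.pi_pos.le
    have h4 : Real.pi * (a₀ / (4 * Real.pi)) = a₀ / 4 := by
      field_simp
    linarith
  -- Step 2: the Abel parameter `ν ∈ (0, ν₀]` with both `ν`-terms of the sandwich `≤ a₀/4`
  obtain ⟨ν, hν, hνν₀, hν1, hν2⟩ : ∃ ν : ℝ, 0 < ν ∧ ν ≤ ν₀ ∧
      2 * c₀ * K * ν / c ^ 2 ≤ a₀ / 4 ∧ Bp * ν / c₀ ^ 2 ≤ a₀ / 4 := by
    refine ⟨min ν₀ (min (a₀ * c ^ 2 / (8 * c₀ * K)) (a₀ * c₀ ^ 2 / (4 * Bp))),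
      lt_min hν₀ (lt_min (by positivity) (by positivity)), min_le_left _ _, ?_, ?_⟩
    · have hle : min ν₀ (min (a₀ * c ^ 2 / (8 * c₀ * K)) (a₀ * c₀ ^ 2 / (4 * Bp))) ≤ a₀ * c ^ 2 / (8 * c₀ * K) :=
        (min_le_right _ _).trans (min_le_left _ _)
      calc 2 * c₀ * K * min ν₀ (min (a₀ * c ^ 2 / (8 * c₀ * K)) (a₀ * c₀ ^ 2 / (4 * Bp))) / c ^ 2
          ≤ 2 * c₀ * K * (a₀ * c ^ 2 / (8 * c₀ * K)) / c ^ 2 := by gcongr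
        _ = a₀ / 4 := by field_simp; ring
    · have hle : min ν₀ (min (a₀ * c ^ 2 / (8 * c₀ * K)) (a₀ * c₀ ^ 2 / (4 * Bp))) ≤ a₀ * c₀ ^ 2 / (4 * Bp) :=
        (min_le_right _ _).trans (min_le_right _ _)
      calc Bp * min ν₀ (min (a₀ * c ^ 2 / (8 * c₀ * K)) (a₀ * c₀ ^ 2 / (4 * Bp))) / c₀ ^ 2
          ≤ Bp * (a₀ * c₀ ^ 2 / (4 * Bp)) / c₀ ^ 2 := by gcongr
        _ = a₀ / 4 := by field_simp
  -- Step 3: the temperature threshold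
  obtain ⟨T₀T, hT₀T, hTw'⟩ := hTw ν hν hνν₀
  refine ⟨min (min T₀F T₀T) T₁b, lt_min (lt_min hT₀F hT₀T) hT₁b, fun T hTpos hTlt => ?_⟩
  have hTF : T < T₀F := hTlt.trans_le ((min_le_left _ _).trans (min_le_left _ _))
  have hTT : T < T₀T := hTlt.trans_le ((min_le_left _ _).trans (min_le_right _ _))
  have hTb : T < T₁b := hTlt.trans_le (min_le_right _ _)
  have hT2 : 0 < T ^ 2 := by positivity
  obtain ⟨μ₁, D₁, hG₁, hsh₁, hD₁, hP₁, σ, hσfin, hCσ, g, hgc, hg0, hgK, hmod, hres⟩ := hFw T hTpos hTF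
  obtain ⟨μ₂, D₂, hG₂, hsh₂, hD₂, hP₂, hfloor⟩ := hTw' T hTpos hTT
  -- the canonical datum at `T` and rigidity of the BM class
  obtain ⟨D, hD, hshD, hZ⟩ := Theorems.MourreDissolution.canonicalDatum ω₂ lam β γ hω hl hβ
  obtain ⟨Z, hG, -, -, hsc⟩ := hZ T hTpos
  have hgood := Theorems.MourreDissolution.goodTriple_of_canonicalDatum hshD Z hG hsc
  have hC₁ : ∀ t, D₁.currentCorrelation μ₁ t = D.currentCorrelation Z.μ t :=
    (Theorems.DrudeDissolution.LineSketch.stub_bmRigidity ω₂ lam β γ hω hl hβ hγ T μ₁ Z.μ D₁ D hTpos hG₁ hG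
      hsh₁ hgood.2.2.2.2.1 hD₁ hD hP₁).2.2
  have hC₂ : ∀ t, D₂.currentCorrelation μ₂ t = D.currentCorrelation Z.μ t :=
    (Theorems.DrudeDissolution.LineSketch.stub_bmRigidity ω₂ lam β γ hω hl hβ hγ T μ₂ Z.μ D₂ D hTpos hG₂ hG
      hsh₂ hgood.2.2.2.2.1 hD₂ hD hP₂).2.2
  have hCσ' : ∀ t, D.currentCorrelation Z.μ t = ∫ ω, Real.cos (ω * t) ∂σ := fun t => (hC₁ t).symm.trans (hCσ t)
  haveI := hσfin
  -- total spectral mass: `σ(ℝ) = C_T(0) ≤ B T² ≤ B⁺ T²`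
  have hmass : σ.real univ ≤ Bp * T ^ 2 := by
    rw [← Theorems.DrudeDissolution.Negative.cosine_zero hCσ']
    exact (le_abs_self _).trans ((hSCB T Z.μ D hTpos hTb hgood 0 le_rfl).trans
      (mul_le_mul_of_nonneg_right hBBp hT2.le))
  -- Step 4: the sandwich at `ν' = ν T²`, window `c₀T²`, inner window `cT²`
  have hν' : 0 < ν * T ^ 2 := by positivity
  have hδpos : 0 < c₀ * T ^ 2 := by positivity
  have hρpos : 0 < c * T ^ 2 := by positivity
  have h0mem : (0 : ℝ) ∈ Ioo (-(c₀ * T ^ 2)) (c₀ * T ^ 2) := ⟨by linarith, hδpos⟩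
  have h0mem' : (0 : ℝ) ∈ Ioo (-(c * T ^ 2)) (c * T ^ 2) := ⟨by linarith, hρpos⟩
  have hg00 : 0 ≤ g 0 := hg0 0 h0mem
  have hmc0 : 0 ≤ m c := by
    have h := hmod c hc hcc₀ 0 h0mem'
    rw [sub_self, abs_zero] at h
    exact h
  have hgM : ∀ ω ∈ Ioo (-(c * T ^ 2)) (c * T ^ 2), g ω ≤ g 0 + m c := by
    intro ω hω
    have h := (abs_le.mp (hmod c hc hcc₀ ω hω)).2
    linarith
  -- Abel mean of `σ` = Laplace transform of the canonical `C_T`, which carries the floor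
  have hA : ∫ t in Ioi (0 : ℝ), Real.exp (-(ν * T ^ 2 * t)) * D.currentCorrelation Z.μ t =
      ∫ ω, ν * T ^ 2 / ((ν * T ^ 2) ^ 2 + ω ^ 2) ∂σ := by
    have e : (fun t => Real.exp (-(ν * T ^ 2 * t)) * D.currentCorrelation Z.μ t) =
        fun t => Real.exp (-(ν * T ^ 2 * t)) * ∫ ω, Real.cos (ω * t) ∂σ := by
      funext t; rw [hCσ' t]
    rw [e]
    exact Theorems.AbelOfSpectralDensity.integral_exp_neg_mul_cosTransform σ hν'
  have hfl : a₀ ≤ ∫ ω, ν * T ^ 2 / ((ν * T ^ 2) ^ 2 + ω ^ 2) ∂σ := by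
    rw [← hA]
    simp only [hC₂] at hfloor
    exact hfloor
  have hup := abelMean_le_of_window σ (M := g 0 + m c) (M' := K) hδpos hρpos hν' (by positivity) hK.le
    hgc hg0 hgK hgM hres
  -- the three error terms at the natural scale are `T`-independent
  have e1 : 2 * (c₀ * T ^ 2) * (ν * T ^ 2 / (c * T ^ 2) ^ 2) * K = 2 * c₀ * K * ν / c ^ 2 := by
    field_simp
  have e2 : ν * T ^ 2 / (c₀ * T ^ 2) ^ 2 * σ.real univ ≤ Bp * ν / c₀ ^ 2 := by
    calc ν * T ^ 2 / (c₀ * T ^ 2) ^ 2 * σ.real univ ≤ ν * T ^ 2 / (c₀ * T ^ 2) ^ 2 * (Bp * T ^ 2) :=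
          mul_le_mul_of_nonneg_left hmass (by positivity)
      _ = Bp * ν / c₀ ^ 2 := by field_simp
  have hπg : a₀ / 4 ≤ Real.pi * g 0 := by
    rw [e1] at hup
    nlinarith [hup, e2, hfl, hmc, hν1, hν2, Real.pi_pos]
  have hgpos : 0 < g 0 := by
    by_contra h
    push Not at h
    have h0 : g 0 = 0 := le_antisymm h hg00
    rw [h0, mul_zero] at hπg
    linarith
  -- the witness: the canonical datum, F's spectral measure and density, window `c₀T²`
  exact ⟨Z.μ, D, hG, hgood.2.1, hgood.2.2.1, σ, hσfin, hCσ', c₀ * T ^ 2, g, hδpos, hgc, hg0, hgpos, hres⟩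

/-! ## Composition: the crux BY NAME from the registered stubs F and T -/

/-- **The line concludes the crux** `EmbeddedDrudeMourre.DrudeDissolution` from F (`stub_windowModulusAtScale`) and T
(`stub_kineticAbelFloor`) by the proved sandwich `spectralWitnesses_of_sandwich` at every admissible parameter point.
(B enters through `kineticAbelFloor_of_kineticLimit`: route KineticCorner's `KineticLimit` ⇒ T.) -/
theorem DrudeDissolution_of : Theses.EmbeddedDrudeMourre.DrudeDissolution :=
  fun ω₂ lam β γ hω hl hβ hγ =>
    spectralWitnesses_of_sandwich hω hl hβ hγ (stub_windowModulusAtScale ω₂ lam β γ hω hl hβ hγ)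
      (stub_kineticAbelFloor ω₂ lam β γ hω hl hβ hγ)

/-! ## B — Abel summation of kinetic window limits (pure analysis, PROVED in v2; the registered stub B of v1)

### Helpers -/

/-- `d/dt e^{-ct} = -c e^{-ct}`. [folklore] -/
theorem hasDerivAt_exp_neg_mul (c t : ℝ) :
    HasDerivAt (fun s => Real.exp (-(c * s))) (-(c * Real.exp (-(c * t)))) t := by
  have h1 : HasDerivAt (fun s : ℝ => -(c * s)) (-c) t := by
    have h := (hasDerivAt_id t).const_mul (-c)
    simp only [id_eq, mul_one, neg_mul] at h
    exact h
  have h2 := h1.exp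
  convert h2 using 1
  ring

/-- `∫_S^M e^{-νs} ds = (e^{-νS} - e^{-νM})/ν` for `ν ≠ 0`. [folklore] -/
theorem integral_exp_neg_mul_interval {ν S M : ℝ} (hν : ν ≠ 0) :
    ∫ s in S..M, Real.exp (-(ν * s)) = (Real.exp (-(ν * S)) - Real.exp (-(ν * M))) / ν := by
  have hderiv : ∀ s ∈ uIcc S M,
      HasDerivAt (fun s => -(Real.exp (-(ν * s))) / ν) (Real.exp (-(ν * s))) s := by
    intro s _
    have hd := (hasDerivAt_exp_neg_mul ν s).neg.div_const ν
    have e : -(-(ν * Real.exp (-(ν * s)))) / ν = Real.exp (-(ν * s)) := by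
      rw [neg_neg, mul_div_cancel_left₀ _ hν]
    rw [e] at hd
    exact hd
  rw [intervalIntegral.integral_eq_sub_of_hasDerivAt hderiv
    ((by fun_prop : Continuous fun s => Real.exp (-(ν * s))).intervalIntegrable _ _)]
  field_simp
  ring

/-- A continuous function bounded by `Bf` on `[0, ∞)` is integrable against `e^{-ct}` on `(0, ∞)`.
[folklore] -/
theorem integrableOn_exp_neg_mul_mul {f : ℝ → ℝ} {c Bf : ℝ} (hc : 0 < c) (hf : Continuous f)
    (hbd : ∀ t, 0 ≤ t → |f t| ≤ Bf) :
    IntegrableOn (fun t => Real.exp (-(c * t)) * f t) (Ioi 0) := by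
  have h0 : IntegrableOn (fun t => Real.exp (-c * t)) (Ioi 0) := exp_neg_integrableOn_Ioi 0 hc
  have h1 : IntegrableOn (fun t => Real.exp (-(c * t))) (Ioi 0) := by
    refine h0.congr_fun (fun t _ => ?_) measurableSet_Ioi
    simp only [neg_mul]
  have hg : IntegrableOn (fun t => Real.exp (-(c * t)) * Bf) (Ioi 0) := h1.mul_const Bf
  refine hg.mono' ((by fun_prop : Continuous fun t => Real.exp (-(c * t)) * f t).aestronglyMeasurable) ?_
  filter_upwards [ae_restrict_mem measurableSet_Ioi] with t ht
  rw [norm_mul, Real.norm_eq_abs, Real.norm_eq_abs, Real.abs_exp]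
  exact mul_le_mul_of_nonneg_left (hbd t (le_of_lt ht)) (Real.exp_pos _).le

/-- Head estimate: `|∫_{(0,a]} g| ≤ Bg·a` if `|g| ≤ Bg` there. [folklore] -/
theorem abs_setIntegral_Ioc_le {g : ℝ → ℝ} {a Bg : ℝ} (ha : 0 ≤ a)
    (hbd : ∀ t ∈ Ioc 0 a, |g t| ≤ Bg) : |∫ t in Ioc 0 a, g t| ≤ Bg * a := by
  have hvol : (volume : Measure ℝ) (Ioc 0 a) < ⊤ := by
    rw [Real.volume_Ioc]; exact ENNReal.ofReal_lt_top
  have hC : ∀ t ∈ Ioc 0 a, ‖g t‖ ≤ Bg := fun t ht => by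
    rw [Real.norm_eq_abs]; exact hbd t ht
  have h := norm_setIntegral_le_of_norm_le_const hvol hC
  rw [Real.norm_eq_abs, Real.volume_real_Ioc_of_le ha, sub_zero] at h
  exact h

/-- Tail estimate: `|∫_{(b,∞)} e^{-ct} f| ≤ Bf e^{-cb}/c` if `|f| ≤ Bf` on `[0, ∞)`, `b ≥ 0`. [folklore] -/
theorem abs_setIntegral_Ioi_exp_le {f : ℝ → ℝ} {c b Bf : ℝ} (hc : 0 < c) (hb : 0 ≤ b)
    (hbd : ∀ t, 0 ≤ t → |f t| ≤ Bf) :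
    |∫ t in Ioi b, Real.exp (-(c * t)) * f t| ≤ Bf * Real.exp (-(c * b)) / c := by
  have h0 : IntegrableOn (fun t => Real.exp (-c * t)) (Ioi b) := exp_neg_integrableOn_Ioi b hc
  have h1 : IntegrableOn (fun t => Real.exp (-(c * t))) (Ioi b) := by
    refine h0.congr_fun (fun t _ => ?_) measurableSet_Ioi
    simp only [neg_mul]
  have hg : IntegrableOn (fun t => Bf * Real.exp (-(c * t))) (Ioi b) := h1.const_mul Bf
  have hC : ∀ᵐ t ∂(volume.restrict (Ioi b)), ‖Real.exp (-(c * t)) * f t‖ ≤ Bf * Real.exp (-(c * t)) := by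
    filter_upwards [ae_restrict_mem measurableSet_Ioi] with t ht
    rw [norm_mul, Real.norm_eq_abs, Real.norm_eq_abs, Real.abs_exp, mul_comm]
    exact mul_le_mul_of_nonneg_right (hbd t (hb.trans (le_of_lt ht))) (Real.exp_pos _).le
  calc |∫ t in Ioi b, Real.exp (-(c * t)) * f t| ≤ ∫ t in Ioi b, Bf * Real.exp (-(c * t)) := by
        rw [← Real.norm_eq_abs]
        exact norm_integral_le_of_norm_le hg hC
    _ = Bf * Real.exp (-(c * b)) / c := by
        rw [integral_const_mul]
        have h := integral_exp_mul_Ioi (a := -c) (by linarith) b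
        have e : (fun x : ℝ => Real.exp (-c * x)) = fun x => Real.exp (-(c * x)) := by
          funext x; rw [neg_mul]
        rw [e] at h
        rw [h, neg_mul, neg_div_neg_eq]
        ring

/-- Integration by parts on a kinetic window followed by the substitution `s = T²t`:
`∫_{δ/T²}^{M/T²} e^{-νT²t} f(t) dt = e^{-νM} ∫_{δ/T²}^{M/T²} f + ν ∫_δ^M e^{-νs} (∫_{δ/T²}^{s/T²} f) ds`
for continuous `f` and `T > 0`. [folklore] -/
theorem window_parts {f : ℝ → ℝ} (hf : Continuous f) {ν T δ M : ℝ} (hT : 0 < T) :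
    ∫ t in (δ / T ^ 2)..(M / T ^ 2), Real.exp (-(ν * T ^ 2 * t)) * f t =
      Real.exp (-(ν * M)) * (∫ t in (δ / T ^ 2)..(M / T ^ 2), f t) +
        ν * ∫ s in δ..M, Real.exp (-(ν * s)) * ∫ t in (δ / T ^ 2)..(s / T ^ 2), f t := by
  have hT2 : (T ^ 2) ≠ 0 := by positivity
  -- integration by parts
  have hu : ∀ x ∈ uIcc (δ / T ^ 2) (M / T ^ 2), HasDerivAt (fun t => Real.exp (-(ν * T ^ 2 * t)))
      (-(ν * T ^ 2 * Real.exp (-(ν * T ^ 2 * x)))) x := fun x _ => hasDerivAt_exp_neg_mul _ x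
  have hv : ∀ x ∈ uIcc (δ / T ^ 2) (M / T ^ 2),
      HasDerivAt (fun u => ∫ t in (δ / T ^ 2)..u, f t) (f x) x :=
    fun x _ => (hf.integral_hasStrictDerivAt (δ / T ^ 2) x).hasDerivAt
  have hparts := intervalIntegral.integral_mul_deriv_eq_deriv_mul hu hv
    ((by fun_prop : Continuous fun x => -(ν * T ^ 2 * Real.exp (-(ν * T ^ 2 * x)))).intervalIntegrable _ _)
    (hf.intervalIntegrable _ _)
  rw [hparts, intervalIntegral.integral_same, mul_zero, sub_zero]
  have hub : Real.exp (-(ν * T ^ 2 * (M / T ^ 2))) = Real.exp (-(ν * M)) := by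
    congr 1
    field_simp
  rw [hub]
  -- the remaining integral: pull out the constant, then substitute `s = T² x`
  have hpull : ∫ x in (δ / T ^ 2)..(M / T ^ 2),
      -(ν * T ^ 2 * Real.exp (-(ν * T ^ 2 * x))) * ∫ t in (δ / T ^ 2)..x, f t =
      -(ν * T ^ 2) * ∫ x in (δ / T ^ 2)..(M / T ^ 2),
        Real.exp (-(ν * T ^ 2 * x)) * ∫ t in (δ / T ^ 2)..x, f t := by
    rw [← intervalIntegral.integral_const_mul]
    congr 1
    funext x
    ring
  have hsub : ∫ s in δ..M, Real.exp (-(ν * s)) * ∫ t in (δ / T ^ 2)..(s / T ^ 2), f t =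
      T ^ 2 * ∫ x in (δ / T ^ 2)..(M / T ^ 2),
        Real.exp (-(ν * T ^ 2 * x)) * ∫ t in (δ / T ^ 2)..x, f t := by
    have h := intervalIntegral.integral_comp_div
      (f := fun x => Real.exp (-(ν * T ^ 2 * x)) * ∫ t in (δ / T ^ 2)..x, f t) (a := δ) (b := M) hT2
    simp only [smul_eq_mul] at h
    rw [← h]
    refine intervalIntegral.integral_congr (fun s _ => ?_)
    have e : ν * T ^ 2 * (s / T ^ 2) = ν * s := by field_simp
    simp only [e]
  rw [hpull, hsub]
  ring

/-- **The floor of the limit functional.** For `F` continuous on `[δ, M]` with `F ≥ 3κ/4` on `[S, M]`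
and `F ≥ -(κ₁ + κ/8)` on `[δ, M]`, and `ν S (3κ/4 + κ₁ + κ/8) ≤ κ/8`:
`5κ/8 ≤ e^{-νM} F(M) + ν ∫_δ^M e^{-νs} F(s) ds`. [folklore] -/
theorem floor_of_primitive_bounds {F : ℝ → ℝ} {ν κ κ₁ δ S M : ℝ} (hν : 0 < ν) (hκ : 0 < κ)
    (hκ₁ : 0 ≤ κ₁) (hδ : 0 < δ) (hδS : δ ≤ S) (hSM : S ≤ M)
    (hFcont : ContinuousOn F (uIcc δ M))
    (hF_hi : ∀ s, S ≤ s → s ≤ M → 3 * κ / 4 ≤ F s)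
    (hF_lo : ∀ s, δ ≤ s → s ≤ M → -(κ₁ + κ / 8) ≤ F s)
    (hνS : ν * S * (3 * κ / 4 + κ₁ + κ / 8) ≤ κ / 8) :
    5 * κ / 8 ≤ Real.exp (-(ν * M)) * F M + ν * ∫ s in δ..M, Real.exp (-(ν * s)) * F s := by
  have hδM : δ ≤ M := hδS.trans hSM
  have hGcont : ContinuousOn (fun s => Real.exp (-(ν * s)) * F s) (uIcc δ M) :=
    (by fun_prop : Continuous fun s => Real.exp (-(ν * s))).continuousOn.mul hFcont
  have hSmem : S ∈ uIcc δ M := mem_uIcc_of_le hδS hSM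
  have hG1 : IntervalIntegrable (fun s => Real.exp (-(ν * s)) * F s) volume δ S :=
    (hGcont.mono (uIcc_subset_uIcc_left hSmem)).intervalIntegrable
  have hG2 : IntervalIntegrable (fun s => Real.exp (-(ν * s)) * F s) volume S M :=
    (hGcont.mono (uIcc_subset_uIcc_right hSmem)).intervalIntegrable
  have hsplit : ∫ s in δ..M, Real.exp (-(ν * s)) * F s =
      (∫ s in δ..S, Real.exp (-(ν * s)) * F s) + ∫ s in S..M, Real.exp (-(ν * s)) * F s :=
    (intervalIntegral.integral_add_adjacent_intervals hG1 hG2).symm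
  -- piece on `[δ, S]`
  have hI1 : (S - δ) * (-(κ₁ + κ / 8)) ≤ ∫ s in δ..S, Real.exp (-(ν * s)) * F s := by
    have h := intervalIntegral.integral_mono_on (f := fun _ => -(κ₁ + κ / 8)) hδS
      intervalIntegrable_const hG1 (fun s hs => ?_)
    · rwa [intervalIntegral.integral_const, smul_eq_mul] at h
    · have hs0 : 0 ≤ s := hδ.le.trans hs.1
      have he1 : Real.exp (-(ν * s)) ≤ 1 := Real.exp_le_one_iff.mpr (by nlinarith)
      have he0 : 0 < Real.exp (-(ν * s)) := Real.exp_pos _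
      have hF := hF_lo s hs.1 (hs.2.trans hSM)
      calc -(κ₁ + κ / 8) ≤ Real.exp (-(ν * s)) * (-(κ₁ + κ / 8)) := by nlinarith
        _ ≤ Real.exp (-(ν * s)) * F s := mul_le_mul_of_nonneg_left hF he0.le
  -- piece on `[S, M]`
  have hexpint := integral_exp_neg_mul_interval (S := S) (M := M) hν.ne'
  have hI2 : 3 * κ / 4 * ((Real.exp (-(ν * S)) - Real.exp (-(ν * M))) / ν) ≤
      ∫ s in S..M, Real.exp (-(ν * s)) * F s := by
    have h := intervalIntegral.integral_mono_on (f := fun s => 3 * κ / 4 * Real.exp (-(ν * s))) hSM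
      ((by fun_prop : Continuous fun s => 3 * κ / 4 * Real.exp (-(ν * s))).intervalIntegrable _ _) hG2
      (fun s hs => ?_)
    · rwa [intervalIntegral.integral_const_mul, hexpint] at h
    · rw [mul_comm]
      exact mul_le_mul_of_nonneg_left (hF_hi s hs.1 hs.2) (Real.exp_pos _).le
  -- first term
  have hI0 : Real.exp (-(ν * M)) * (3 * κ / 4) ≤ Real.exp (-(ν * M)) * F M :=
    mul_le_mul_of_nonneg_left (hF_hi M hSM le_rfl) (Real.exp_pos _).le
  -- `e^{-νS} ≥ 1 - νS`
  have hexpS : 1 - ν * S ≤ Real.exp (-(ν * S)) := by linarith [Real.add_one_le_exp (-(ν * S))]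
  have hexpS' : 3 * κ / 4 * (1 - ν * S) ≤ 3 * κ / 4 * Real.exp (-(ν * S)) :=
    mul_le_mul_of_nonneg_left hexpS (by positivity)
  have f1 : ν * ((S - δ) * (-(κ₁ + κ / 8))) ≤ ν * ∫ s in δ..S, Real.exp (-(ν * s)) * F s :=
    mul_le_mul_of_nonneg_left hI1 hν.le
  have f2 : ν * (3 * κ / 4 * ((Real.exp (-(ν * S)) - Real.exp (-(ν * M))) / ν)) ≤
      ν * ∫ s in S..M, Real.exp (-(ν * s)) * F s :=
    mul_le_mul_of_nonneg_left hI2 hν.le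
  have hkey : ν * (3 * κ / 4 * ((Real.exp (-(ν * S)) - Real.exp (-(ν * M))) / ν)) =
      3 * κ / 4 * (Real.exp (-(ν * S)) - Real.exp (-(ν * M))) := by
    field_simp
  have e1 : ν * ((S - δ) * (-(κ₁ + κ / 8))) = -(ν * S * (κ₁ + κ / 8)) + ν * δ * (κ₁ + κ / 8) := by
    ring
  have e2 : ν * S * (3 * κ / 4 + κ₁ + κ / 8) = 3 * κ / 4 * (ν * S) + ν * S * (κ₁ + κ / 8) := by
    ring
  have h3 : 0 ≤ ν * δ * (κ₁ + κ / 8) := by positivity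
  rw [hsplit, mul_add]
  rw [e1] at f1
  rw [hkey] at f2
  linarith [hI0, f1, f2, hexpS', h3, hνS, e2]

/-- **The middle functional converges** (integration by parts + dominated convergence): for a family
`C T` continuous with `|C T t| ≤ Bp T²` (`t ≥ 0`, `0 < T < T₁`) whose window integrals
`∫_{δ/T²}^{s/T²} C T` converge to `FK s` for every `s ≥ δ` as `T ↓ 0`,
`e^{-νM} ∫_{δ/T²}^{M/T²} C T + ν ∫_δ^M e^{-νs} (∫_{δ/T²}^{s/T²} C T) ds → e^{-νM} FK(M) + ν ∫_δ^M e^{-νs} FK(s) ds`.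
[folklore] -/
theorem tendsto_middle {C : ℝ → ℝ → ℝ} {FK : ℝ → ℝ} {T₁ Bp ν δ M : ℝ} (hT₁ : 0 < T₁)
    (hδ : 0 < δ) (hδM : δ ≤ M)
    (hcont : ∀ T : ℝ, 0 < T → T < T₁ → Continuous (C T))
    (hbd : ∀ T : ℝ, 0 < T → T < T₁ → ∀ t : ℝ, 0 ≤ t → |C T t| ≤ Bp * T ^ 2)
    (hptw : ∀ s : ℝ, δ ≤ s →
      Tendsto (fun T : ℝ => ∫ t in (δ / T ^ 2)..(s / T ^ 2), C T t) (𝓝[>] 0) (𝓝 (FK s))) :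
    Tendsto (fun T : ℝ => Real.exp (-(ν * M)) * (∫ t in (δ / T ^ 2)..(M / T ^ 2), C T t) +
        ν * ∫ s in δ..M, Real.exp (-(ν * s)) * ∫ t in (δ / T ^ 2)..(s / T ^ 2), C T t)
      (𝓝[>] 0) (𝓝 (Real.exp (-(ν * M)) * FK M + ν * ∫ s in δ..M, Real.exp (-(ν * s)) * FK s)) := by
  have hDCT : Tendsto (fun T : ℝ => ∫ s in δ..M,
        Real.exp (-(ν * s)) * ∫ t in (δ / T ^ 2)..(s / T ^ 2), C T t)
      (𝓝[>] 0) (𝓝 (∫ s in δ..M, Real.exp (-(ν * s)) * FK s)) := by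
    refine intervalIntegral.tendsto_integral_filter_of_dominated_convergence
      (fun _ => Real.exp (|ν| * M) * (Bp * (M - δ))) ?_ ?_ intervalIntegrable_const ?_
    · filter_upwards [Ioo_mem_nhdsGT hT₁] with T hT
      have hc : Continuous fun s : ℝ => ∫ t in (δ / T ^ 2)..(s / T ^ 2), C T t :=
        (intervalIntegral.continuous_primitive (fun a b => (hcont T hT.1 hT.2).intervalIntegrable a b)
          (δ / T ^ 2)).comp (continuous_id.div_const (T ^ 2))
      exact ((by fun_prop : Continuous fun s => Real.exp (-(ν * s))).mul hc).aestronglyMeasurable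
    · filter_upwards [Ioo_mem_nhdsGT hT₁] with T hT
      refine ae_of_all _ fun s hs => ?_
      rw [uIoc_of_le hδM] at hs
      have hT0 : 0 < T := hT.1
      have hs0 : 0 < s := hδ.trans hs.1
      have hT2 : 0 < T ^ 2 := by positivity
      have hF : |∫ t in (δ / T ^ 2)..(s / T ^ 2), C T t| ≤ Bp * T ^ 2 * |s / T ^ 2 - δ / T ^ 2| := by
        have hC' : ∀ t ∈ uIoc (δ / T ^ 2) (s / T ^ 2), ‖C T t‖ ≤ Bp * T ^ 2 := by
          intro t ht
          rw [Real.norm_eq_abs]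
          refine hbd T hT.1 hT.2 t (le_of_lt (lt_of_le_of_lt (le_min ?_ ?_) ht.1)) <;> positivity
        have h := intervalIntegral.norm_integral_le_of_norm_le_const hC'
        rw [Real.norm_eq_abs] at h
        exact h
      rw [norm_mul, Real.norm_eq_abs, Real.norm_eq_abs, Real.abs_exp]
      have he : Real.exp (-(ν * s)) ≤ Real.exp (|ν| * M) := by
        refine Real.exp_le_exp.mpr ?_
        have h1 : -(ν * s) ≤ |ν| * s := by
          have := neg_abs_le ν
          nlinarith
        have h2 : |ν| * s ≤ |ν| * M := mul_le_mul_of_nonneg_left hs.2 (abs_nonneg ν)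
        linarith
      have hdiff : |s / T ^ 2 - δ / T ^ 2| = (s - δ) / T ^ 2 := by
        rw [abs_of_nonneg (by rw [← sub_div]; exact div_nonneg (by linarith [hs.1]) hT2.le)]
        ring
      calc Real.exp (-(ν * s)) * |∫ t in (δ / T ^ 2)..(s / T ^ 2), C T t|
          ≤ Real.exp (|ν| * M) * (Bp * T ^ 2 * |s / T ^ 2 - δ / T ^ 2|) :=
            mul_le_mul he hF (abs_nonneg _) (Real.exp_pos _).le
        _ = Real.exp (|ν| * M) * (Bp * (s - δ)) := by rw [hdiff]; field_simp
        _ ≤ Real.exp (|ν| * M) * (Bp * (M - δ)) := by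
            have hBp : 0 ≤ Bp := by
              have h := hbd T hT.1 hT.2 0 le_rfl
              have : 0 ≤ Bp * T ^ 2 := (abs_nonneg _).trans h
              nlinarith
            gcongr
            exact hs.2
    · refine ae_of_all _ fun s hs => ?_
      rw [uIoc_of_le hδM] at hs
      exact tendsto_const_nhds.mul (hptw s hs.1.le)
  exact ((hptw M hδM).const_mul _).add (hDCT.const_mul ν)

/-! ### B -/

/-- **B `abelFloor_of_windowLimits` — ABEL SUMMATION OF KINETIC WINDOW LIMITS** (pure real analysis;
registered as the stub `stub_abelFloor_of_windowLimits` in skeleton v1, PROVED in v2). Let `C : ℝ → ℝ → ℝ` be a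
family of continuous functions `C T` (`0 < T < T₁`) with `|C T t| ≤ B T²` for `t ≥ 0`, and `K ∈ L¹(0,∞)` with
`∫₀^∞ K > 0`, such that for all `0 < δ ≤ M`, `e > 0` and `T < T₀(δ, M, e)`: `|∫_{δT⁻²}^{MT⁻²} C T − ∫_δ^M K| ≤ e`
(the shape of `KineticCorner.KineticLimit`). Then there are `a₀, ν₀ > 0` such that for every `ν ∈ (0, ν₀]`, for
`T` small, `∫₀^∞ e^{−νT²t} C T t dt ≥ a₀`. Proof: `κ := ∫₀^∞K`, `Φ(s) := ∫₀^s K → κ`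
(`intervalIntegral_tendsto_integral_Ioi`), `S ≥ 1` with `Φ ≥ 7κ/8` beyond `S`, `ν₀ := κ/(8 S L₀)`,
`L₀ := 3κ/4 + ‖K‖₁ + κ/8`; given `ν ≤ ν₀`: `δ ≤ 1` with `∫_{(0,δ]}|K| ≤ κ/8` and `Bδ ≤ κ/16`
(`targetGlue_exists_head_le`), `M ≥ S` with `B e^{−νM}/ν ≤ κ/16` (`e^{x} ≥ 1 + x`); split
`∫₀^∞ = ∫_{(0,δT⁻²]} + ∫_{(δT⁻²,MT⁻²]} + ∫_{(MT⁻²,∞)}` (`targetGlue_setIntegral_Ioi_eq_add_three`): head `≤ Bδ`,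
tail `≤ B e^{−νM}/ν`; middle = `e^{−νM}F_T(M) + ν∫_δ^M e^{−νs}F_T(s)ds` by parts + substitution (`window_parts`,
`F_T(s) := ∫_{δT⁻²}^{sT⁻²} C T`), which tends (dominated convergence in `s`, `tendsto_middle`) to
`Λ := e^{−νM}F_K(M) + ν∫_δ^M e^{−νs}F_K(s)ds ≥ 5κ/8` (`floor_of_primitive_bounds`: `F_K = Φ − Φ(δ) ≥ 3κ/4` on
`[S, M]`, `≥ −(‖K‖₁ + κ/8)` on `[δ, S]`, `e^{−νS} ≥ 1 − νS`); so the Abel mean is `≥ 5κ/8 − 3κ/16 ≥ κ/4 =: a₀`.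
[folklore; cite: BonettoLebowitzReyBellet2000 §6.3 (Abel regularisation)] -/
theorem abelFloor_of_windowLimits :
    ∀ (C : ℝ → ℝ → ℝ) (K : ℝ → ℝ) (B T₁ : ℝ), 0 < T₁ →
      MeasureTheory.IntegrableOn K (Set.Ioi 0) → 0 < ∫ τ in Set.Ioi 0, K τ →
      (∀ T : ℝ, 0 < T → T < T₁ → Continuous (C T)) →
      (∀ T : ℝ, 0 < T → T < T₁ → ∀ t : ℝ, 0 ≤ t → |C T t| ≤ B * T ^ 2) →
      (∀ δ M e : ℝ, 0 < δ → δ ≤ M → 0 < e → ∃ T₀ : ℝ, 0 < T₀ ∧ ∀ T : ℝ, 0 < T → T < T₀ →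
          |(∫ t in (δ / T ^ 2)..(M / T ^ 2), C T t) - ∫ τ in δ..M, K τ| ≤ e) →
      ∃ a₀ ν₀ : ℝ, 0 < a₀ ∧ 0 < ν₀ ∧ ∀ ν : ℝ, 0 < ν → ν ≤ ν₀ →
        ∃ T₀ : ℝ, 0 < T₀ ∧ ∀ T : ℝ, 0 < T → T < T₀ →
          a₀ ≤ ∫ t in Set.Ioi (0 : ℝ), Real.exp (-(ν * T ^ 2 * t)) * C T t := by
  intro C K B T₁ hT₁ hKint hκpos hcont hbd hwin
  set κ : ℝ := ∫ τ in Ioi 0, K τ with hκ_def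
  set κ₁ : ℝ := ∫ τ in Ioi 0, |K τ| with hκ₁_def
  have hκ₁nn : 0 ≤ κ₁ := setIntegral_nonneg measurableSet_Ioi fun _ _ => abs_nonneg _
  -- a positive bound `Bp ≥ B`
  obtain ⟨Bp, hBp, hBBp⟩ : ∃ Bp : ℝ, 0 < Bp ∧ B ≤ Bp :=
    ⟨max B 1, lt_max_of_lt_right one_pos, le_max_left _ _⟩
  have hbd' : ∀ T : ℝ, 0 < T → T < T₁ → ∀ t : ℝ, 0 ≤ t → |C T t| ≤ Bp * T ^ 2 :=
    fun T hT hTlt t ht => (hbd T hT hTlt t ht).trans (mul_le_mul_of_nonneg_right hBBp (by positivity))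
  -- interval integrability of `K` on subintervals of `[0, ∞)`
  have hKI : ∀ a b : ℝ, 0 ≤ a → 0 ≤ b → IntervalIntegrable K volume a b := by
    intro a b ha hb
    rw [intervalIntegrable_iff]
    exact hKint.mono_set fun x hx => lt_of_le_of_lt (le_min ha hb) hx.1
  -- `Φ(s) := ∫_0^s K → κ` and `|Φ| ≤ κ₁`
  have hΦ : Tendsto (fun s => ∫ x in (0:ℝ)..s, K x) atTop (𝓝 κ) :=
    intervalIntegral_tendsto_integral_Ioi 0 hKint tendsto_id
  have hΦbd : ∀ s : ℝ, 0 ≤ s → |∫ x in (0:ℝ)..s, K x| ≤ κ₁ := by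
    intro s hs
    rw [intervalIntegral.integral_of_le hs]
    calc |∫ x in Ioc 0 s, K x| ≤ ∫ x in Ioc 0 s, |K x| := abs_integral_le_integral_abs
      _ ≤ κ₁ := setIntegral_mono_set hKint.abs (ae_of_all _ fun _ => abs_nonneg _)
          (ae_of_all _ Ioc_subset_Ioi_self)
  -- `S ≥ 1` with `Φ ≥ κ − κ/8` beyond `S`
  obtain ⟨S₀, hS₀⟩ := Metric.tendsto_atTop.1 hΦ (κ / 8) (by positivity)
  obtain ⟨S, hS1, hS₀S⟩ : ∃ S : ℝ, 1 ≤ S ∧ S₀ ≤ S := ⟨max S₀ 1, le_max_right _ _, le_max_left _ _⟩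
  have hSpos : 0 < S := one_pos.trans_le hS1
  have hΦS : ∀ s : ℝ, S ≤ s → κ - κ / 8 ≤ ∫ x in (0:ℝ)..s, K x := by
    intro s hs
    have h := hS₀ s (hS₀S.trans hs)
    rw [Real.dist_eq] at h
    have := (abs_lt.1 h).1
    linarith
  -- the Abel threshold `ν₀`
  obtain ⟨L₀, hL₀⟩ : ∃ L₀ : ℝ, L₀ = 3 * κ / 4 + κ₁ + κ / 8 := ⟨_, rfl⟩
  have hL₀pos : 0 < L₀ := by rw [hL₀]; positivity
  refine ⟨κ / 4, κ / (8 * S * L₀), by positivity, by positivity, fun ν hν hνle => ?_⟩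
  have hνSL : ν * S * (3 * κ / 4 + κ₁ + κ / 8) ≤ κ / 8 := by
    have h := (le_div_iff₀ (by positivity)).1 hνle
    rw [← hL₀]
    linarith
  -- `δ`: head of `K` ≤ κ/8, `Bp δ ≤ κ/16`, `δ ≤ 1 ≤ S`
  obtain ⟨δ₀, hδ₀, hhead⟩ :=
    Theorems.DrudeDissolution.LineSketch.targetGlue_exists_head_le hKint (ε := κ / 8) (by positivity)
  obtain ⟨δ, hδpos, hδδ₀, hδB, hδ1⟩ : ∃ δ : ℝ, 0 < δ ∧ δ ≤ δ₀ ∧ Bp * δ ≤ κ / 16 ∧ δ ≤ 1 := by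
    refine ⟨min δ₀ (min (κ / (16 * Bp)) 1), lt_min hδ₀ (lt_min (by positivity) one_pos),
      min_le_left _ _, ?_, (min_le_right _ _).trans (min_le_right _ _)⟩
    have h : min δ₀ (min (κ / (16 * Bp)) 1) ≤ κ / (16 * Bp) :=
      (min_le_right _ _).trans (min_le_left _ _)
    calc Bp * min δ₀ (min (κ / (16 * Bp)) 1) ≤ Bp * (κ / (16 * Bp)) := by gcongr
      _ = κ / 16 := by field_simp
  have hδS : δ ≤ S := hδ1.trans hS1
  have hheadδ : ∫ x in Ioc 0 δ, |K x| ≤ κ / 8 := hhead δ hδδ₀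
  -- `M ≥ S` with `Bp e^{-νM}/ν ≤ κ/16`
  obtain ⟨M, hSM, hMtail⟩ : ∃ M : ℝ, S ≤ M ∧ Bp * Real.exp (-(ν * M)) / ν ≤ κ / 16 := by
    obtain ⟨M, hM1, hM2⟩ : ∃ M : ℝ, S ≤ M ∧ 16 * Bp / (ν ^ 2 * κ) ≤ M :=
      ⟨max S (16 * Bp / (ν ^ 2 * κ)), le_max_left _ _, le_max_right _ _⟩
    refine ⟨M, hM1, ?_⟩
    have hMpos : 0 < M := hSpos.trans_le hM1
    have hM2' : 16 * Bp ≤ M * (ν ^ 2 * κ) := (div_le_iff₀ (by positivity)).1 hM2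
    have hexp : ν * M ≤ Real.exp (ν * M) := by linarith [Real.add_one_le_exp (ν * M)]
    have h1 : Real.exp (-(ν * M)) ≤ 1 / (ν * M) := by
      rw [Real.exp_neg, ← one_div]
      exact one_div_le_one_div_of_le (by positivity) hexp
    calc Bp * Real.exp (-(ν * M)) / ν ≤ Bp * (1 / (ν * M)) / ν := by gcongr
      _ = Bp / (ν ^ 2 * M) := by field_simp
      _ ≤ κ / 16 := by
          rw [div_le_div_iff₀ (by positivity) (by positivity)]
          nlinarith [hM2']
  have hδM : δ ≤ M := hδS.trans hSM
  -- the `K`-side primitive `F_K(s) := ∫_δ^s K`: continuity on `[δ, M]` and the two bounds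
  have hKIcc : IntegrableOn K (uIcc δ M) :=
    hKint.mono_set fun x hx => by
      rw [uIcc_of_le hδM] at hx
      exact hδpos.trans_le hx.1
  have hFKcont : ContinuousOn (fun s => ∫ x in δ..s, K x) (uIcc δ M) :=
    intervalIntegral.continuousOn_primitive_interval hKIcc
  have hFK : ∀ s, 0 ≤ s → ∫ x in δ..s, K x = (∫ x in (0:ℝ)..s, K x) - ∫ x in (0:ℝ)..δ, K x :=
    fun s hs => (intervalIntegral.integral_interval_sub_left (hKI 0 s le_rfl hs)
      (hKI 0 δ le_rfl hδpos.le)).symm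
  have hΦδ : |∫ x in (0:ℝ)..δ, K x| ≤ κ / 8 := by
    rw [intervalIntegral.integral_of_le hδpos.le]
    exact abs_integral_le_integral_abs.trans hheadδ
  have hFK_hi : ∀ s, S ≤ s → s ≤ M → 3 * κ / 4 ≤ ∫ x in δ..s, K x := by
    intro s hs _
    rw [hFK s (hSpos.le.trans hs)]
    have h1 := hΦS s hs
    have h2 := (abs_le.1 hΦδ).2
    linarith
  have hFK_lo : ∀ s, δ ≤ s → s ≤ M → -(κ₁ + κ / 8) ≤ ∫ x in δ..s, K x := by
    intro s hs _
    have hs0 : 0 ≤ s := hδpos.le.trans hs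
    rw [hFK s hs0]
    have h1 := (abs_le.1 (hΦbd s hs0)).1
    have h2 := (abs_le.1 hΦδ).2
    linarith
  have hΛ_lb := floor_of_primitive_bounds hν hκpos hκ₁nn hδpos hδS hSM hFKcont hFK_hi hFK_lo hνSL
  -- the `C`-side: window limits as `Tendsto`, then the middle functional converges
  have hptw : ∀ s : ℝ, δ ≤ s →
      Tendsto (fun T : ℝ => ∫ t in (δ / T ^ 2)..(s / T ^ 2), C T t) (𝓝[>] 0) (𝓝 (∫ x in δ..s, K x)) := by
    intro s hs
    refine Metric.tendsto_nhds.2 fun ε hε => ?_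
    obtain ⟨T₀, hT₀, h⟩ := hwin δ s (ε / 2) hδpos hs (half_pos hε)
    filter_upwards [Ioo_mem_nhdsGT hT₀] with T hT
    rw [Real.dist_eq]
    exact (h T hT.1 hT.2).trans_lt (half_lt_self hε)
  have hmid := tendsto_middle (ν := ν) hT₁ hδpos hδM hcont hbd' hptw
  have hev := Metric.tendsto_nhds.1 hmid (κ / 16) (by positivity)
  obtain ⟨T₀', hT₀', hsub⟩ := mem_nhdsGT_iff_exists_Ioo_subset.1 hev
  refine ⟨min T₀' T₁, lt_min hT₀' hT₁, fun T hT hTlt => ?_⟩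
  have hT' : T < T₀' := hTlt.trans_le (min_le_left _ _)
  have hT1 : T < T₁ := hTlt.trans_le (min_le_right _ _)
  have hT2 : 0 < T ^ 2 := by positivity
  have hνT : 0 < ν * T ^ 2 := by positivity
  have hclose : dist (Real.exp (-(ν * M)) * (∫ t in (δ / T ^ 2)..(M / T ^ 2), C T t) +
      ν * ∫ s in δ..M, Real.exp (-(ν * s)) * ∫ t in (δ / T ^ 2)..(s / T ^ 2), C T t)
      (Real.exp (-(ν * M)) * (∫ x in δ..M, K x) + ν * ∫ s in δ..M, Real.exp (-(ν * s)) * ∫ x in δ..s, K x)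
        < κ / 16 :=
    hsub ⟨hT, hT'⟩
  rw [Real.dist_eq] at hclose
  -- split `(0, ∞)` at `δ/T²` and `M/T²`
  have ha0 : 0 ≤ δ / T ^ 2 := by positivity
  have hab : δ / T ^ 2 ≤ M / T ^ 2 := div_le_div_of_nonneg_right hδM hT2.le
  have hInt : IntegrableOn (fun t => Real.exp (-(ν * T ^ 2 * t)) * C T t) (Ioi 0) :=
    integrableOn_exp_neg_mul_mul hνT (hcont T hT hT1) (hbd' T hT hT1)
  rw [Theorems.DrudeDissolution.LineSketch.targetGlue_setIntegral_Ioi_eq_add_three hInt ha0 hab]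
  -- head
  have hhd : |∫ t in Ioc 0 (δ / T ^ 2), Real.exp (-(ν * T ^ 2 * t)) * C T t| ≤ κ / 16 := by
    have hC' : ∀ t ∈ Ioc 0 (δ / T ^ 2), |Real.exp (-(ν * T ^ 2 * t)) * C T t| ≤ Bp * T ^ 2 := by
      intro t ht
      rw [abs_mul, Real.abs_exp]
      calc Real.exp (-(ν * T ^ 2 * t)) * |C T t| ≤ 1 * (Bp * T ^ 2) :=
            mul_le_mul (Real.exp_le_one_iff.mpr (by nlinarith [ht.1])) (hbd' T hT hT1 t ht.1.le)
              (abs_nonneg _) zero_le_one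
        _ = Bp * T ^ 2 := one_mul _
    calc _ ≤ Bp * T ^ 2 * (δ / T ^ 2) := abs_setIntegral_Ioc_le ha0 hC'
      _ = Bp * δ := by field_simp
      _ ≤ κ / 16 := hδB
  -- tail
  have htl : |∫ t in Ioi (M / T ^ 2), Real.exp (-(ν * T ^ 2 * t)) * C T t| ≤ κ / 16 := by
    have h := abs_setIntegral_Ioi_exp_le hνT (ha0.trans hab) (hbd' T hT hT1)
    have e : ν * T ^ 2 * (M / T ^ 2) = ν * M := by field_simp
    calc _ ≤ Bp * T ^ 2 * Real.exp (-(ν * T ^ 2 * (M / T ^ 2))) / (ν * T ^ 2) := h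
      _ = Bp * Real.exp (-(ν * M)) / ν := by rw [e]; field_simp
      _ ≤ κ / 16 := hMtail
  -- middle
  have hmd : ∫ t in Ioc (δ / T ^ 2) (M / T ^ 2), Real.exp (-(ν * T ^ 2 * t)) * C T t =
      Real.exp (-(ν * M)) * (∫ t in (δ / T ^ 2)..(M / T ^ 2), C T t) +
        ν * ∫ s in δ..M, Real.exp (-(ν * s)) * ∫ t in (δ / T ^ 2)..(s / T ^ 2), C T t := by
    rw [← intervalIntegral.integral_of_le hab]
    exact window_parts (hcont T hT hT1) hT
  rw [hmd]
  have h1 := abs_lt.1 hclose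
  have h2 := abs_le.1 hhd
  have h3 := abs_le.1 htl
  linarith [hΛ_lb, h1.1, h2.1, h3.1]

/-! ## The time side from route KineticCorner's `KineticLimit` (stmt-3431) through B -/

/-- **B ∧ KL∃ ⇒ T.** The existential Buttà–Marchioro form KL∃ of `KineticCorner.KineticLimit` (verbatim the registered stub
`stub_bmKineticLimit` of line `Sketch`; implied by stmt-3431 via the landed `LineSketch.bmKineticLimit_of_kineticLimit`,
p127311) and the Abel-summation lemma B give the kinetic Abel floor T: the canonical datum `D` of `canonicalDatum` with its
DLR states `Z_T.μ` defines ONE family `C T := D.currentCorrelation Z_T.μ` (continuous, `|C T t| ≤ B T²` for `T < T₁` by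
`KineticCorner.stationaryCorrelationBound_proof`, stmt-3435); every KL∃-pair at `T` has this `C T` by rigidity
(`LineSketch.stub_bmRigidity`), so B applies, and the T-witness at `T` is the canonical datum itself. [folklore] -/
theorem kineticAbelFloor_of_bmKineticLimit
    (hB : ∀ (C : ℝ → ℝ → ℝ) (K : ℝ → ℝ) (B T₁ : ℝ), 0 < T₁ →
      IntegrableOn K (Ioi 0) → 0 < ∫ τ in Ioi 0, K τ →
      (∀ T : ℝ, 0 < T → T < T₁ → Continuous (C T)) →
      (∀ T : ℝ, 0 < T → T < T₁ → ∀ t : ℝ, 0 ≤ t → |C T t| ≤ B * T ^ 2) →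
      (∀ δ M e : ℝ, 0 < δ → δ ≤ M → 0 < e → ∃ T₀ : ℝ, 0 < T₀ ∧ ∀ T : ℝ, 0 < T → T < T₀ →
          |(∫ t in (δ / T ^ 2)..(M / T ^ 2), C T t) - ∫ τ in δ..M, K τ| ≤ e) →
      ∃ a₀ ν₀ : ℝ, 0 < a₀ ∧ 0 < ν₀ ∧ ∀ ν : ℝ, 0 < ν → ν ≤ ν₀ →
        ∃ T₀ : ℝ, 0 < T₀ ∧ ∀ T : ℝ, 0 < T → T < T₀ →
          a₀ ≤ ∫ t in Ioi (0 : ℝ), Real.exp (-(ν * T ^ 2 * t)) * C T t)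
    (hKL : ∀ ω₂ lam β γ : ℝ, 0 < ω₂ → 0 < lam → 0 < β → 0 < γ →
      ∃ K : ℝ → ℝ, IntegrableOn K (Ioi 0) ∧ 0 < ∫ τ in Ioi 0, K τ ∧
        ∀ δ M e : ℝ, 0 < δ → δ ≤ M → 0 < e → ∃ T₀ : ℝ, 0 < T₀ ∧ ∀ T : ℝ, 0 < T → T < T₀ →
          ∃ (μ : Measure ChainConfig) (D : InfiniteChainDynamics (pinnedChain ω₂ lam β γ)),
            (pinnedChain ω₂ lam β γ).IsChainGibbsMeasure T μ ∧
            MeasurePreserving (fun σ : ChainConfig => fun i : ℤ => σ (i + 1)) μ μ ∧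
            D.carrier = (pinnedChain ω₂ lam β γ).bmGood ∧
            D.PreservesMeasure μ ∧
            |(∫ t in (δ / T ^ 2)..(M / T ^ 2), D.currentCorrelation μ t) - ∫ τ in δ..M, K τ| ≤ e) :
    ∀ ω₂ lam β γ : ℝ, 0 < ω₂ → 0 < lam → 0 < β → 0 < γ →
      ∃ a₀ ν₀ : ℝ, 0 < a₀ ∧ 0 < ν₀ ∧ ∀ ν : ℝ, 0 < ν → ν ≤ ν₀ →
        ∃ T₀ : ℝ, 0 < T₀ ∧ ∀ T : ℝ, 0 < T → T < T₀ →
          ∃ (μ : Measure ChainConfig) (D : InfiniteChainDynamics (pinnedChain ω₂ lam β γ)),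
            (pinnedChain ω₂ lam β γ).IsChainGibbsMeasure T μ ∧
            MeasurePreserving (fun σ : ChainConfig => fun i : ℤ => σ (i + 1)) μ μ ∧
            D.carrier = (pinnedChain ω₂ lam β γ).bmGood ∧
            D.PreservesMeasure μ ∧
            a₀ ≤ ∫ t in Ioi (0 : ℝ), Real.exp (-(ν * T ^ 2 * t)) * D.currentCorrelation μ t := by
  intro ω₂ lam β γ hω hl hβ hγ
  obtain ⟨K, hKint, hKpos, hwin⟩ := hKL ω₂ lam β γ hω hl hβ hγ
  obtain ⟨B, T₁, hT₁, hSCB⟩ := Theorems.KineticCorner.stationaryCorrelationBound_proof ω₂ lam β γ hω hl hβ hγ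
  obtain ⟨D, hD, hshD, hZ⟩ := Theorems.MourreDissolution.canonicalDatum ω₂ lam β γ hω hl hβ
  classical
  -- the canonical correlation family (junk value `0` at `T ≤ 0`)
  let C : ℝ → ℝ → ℝ := fun T t =>
    if hT : 0 < T then D.currentCorrelation (Classical.choose (hZ T hT)).μ t else 0
  have hC : ∀ (T : ℝ) (hT : 0 < T), C T = D.currentCorrelation (Classical.choose (hZ T hT)).μ := by
    intro T hT
    funext t
    simp only [C, dif_pos hT]
  -- its properties: continuity, a-priori bound, window limits (by rigidity)
  have hgoodT : ∀ (T : ℝ) (hT : 0 < T),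
      (pinnedChain ω₂ lam β γ).IsChainGibbsMeasure T (Classical.choose (hZ T hT)).μ ∧
      D.PreservesMeasure (Classical.choose (hZ T hT)).μ ∧
      (∀ t : ℝ, D.HasAbsConvergentCorrelation (Classical.choose (hZ T hT)).μ t) ∧
      (∀ S : ℝ, IntegrableOn (D.currentCorrelation (Classical.choose (hZ T hT)).μ) (Set.Icc 0 S)) ∧
      MeasurePreserving (fun σ : ChainConfig => fun i : ℤ => σ (i + 1))
        (Classical.choose (hZ T hT)).μ (Classical.choose (hZ T hT)).μ ∧
      (∀ (t : ℝ) (σ : ChainConfig), D.flow t (fun i : ℤ => σ (i + 1)) = fun i : ℤ => D.flow t σ (i + 1)) :=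
    fun T hT => Theorems.MourreDissolution.goodTriple_of_canonicalDatum hshD _
      (Classical.choose_spec (hZ T hT)).1 (Classical.choose_spec (hZ T hT)).2.2.2
  have hcont : ∀ T : ℝ, 0 < T → T < T₁ → Continuous (C T) := by
    intro T hT _
    rw [hC T hT]
    exact (Theorems.DrudeDissolution.LineSketch.regular_of_zeroWavenumberData _
      (Classical.choose_spec (hZ T hT)).1 (Classical.choose_spec (hZ T hT)).2.2.2).2.2.1
  have hbd : ∀ T : ℝ, 0 < T → T < T₁ → ∀ t : ℝ, 0 ≤ t → |C T t| ≤ B * T ^ 2 := by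
    intro T hT hTlt t ht
    rw [hC T hT]
    exact hSCB T _ D hT hTlt (hgoodT T hT) t ht
  have hwin' : ∀ δ M e : ℝ, 0 < δ → δ ≤ M → 0 < e → ∃ T₀ : ℝ, 0 < T₀ ∧ ∀ T : ℝ, 0 < T → T < T₀ →
      |(∫ t in (δ / T ^ 2)..(M / T ^ 2), C T t) - ∫ τ in δ..M, K τ| ≤ e := by
    intro δ M e hδ hδM he
    obtain ⟨T₀, hT₀, hw⟩ := hwin δ M e hδ hδM he
    refine ⟨T₀, hT₀, fun T hT hTlt => ?_⟩
    obtain ⟨μ₂, D₂, hG₂, hsh₂, hD₂, hP₂, hw₂⟩ := hw T hT hTlt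
    have hC₂ : ∀ t, D₂.currentCorrelation μ₂ t = D.currentCorrelation (Classical.choose (hZ T hT)).μ t :=
      (Theorems.DrudeDissolution.LineSketch.stub_bmRigidity ω₂ lam β γ hω hl hβ hγ T μ₂ _ D₂ D hT hG₂
        (hgoodT T hT).1 hsh₂ (hgoodT T hT).2.2.2.2.1 hD₂ hD hP₂).2.2
    rw [hC T hT]
    simp only [hC₂] at hw₂
    exact hw₂
  obtain ⟨a₀, ν₀, ha₀, hν₀, hfloor⟩ := hB C K B T₁ hT₁ hKint hKpos hcont hbd hwin'
  refine ⟨a₀, ν₀, ha₀, hν₀, fun ν hν hνle => ?_⟩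
  obtain ⟨T₀, hT₀, hfl⟩ := hfloor ν hν hνle
  refine ⟨T₀, hT₀, fun T hT hTlt => ?_⟩
  refine ⟨(Classical.choose (hZ T hT)).μ, D, (hgoodT T hT).1, (hgoodT T hT).2.2.2.2.1, hD, (hgoodT T hT).2.1, ?_⟩
  rw [← hC T hT]
  exact hfl T hT hTlt

/-- **KineticCorner's `KineticLimit` (stmt-3431) ⇒ T** (PROVED implication), through the landed
`LineSketch.bmKineticLimit_of_kineticLimit` (p127311), the rigidity plumbing `kineticAbelFloor_of_bmKineticLimit` and the
proved Abel summation B: landing stmt-3431 closes the time side T; with F, `spectralWitnesses_of_sandwich` then closes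
the crux. CONDITIONAL only on its hypothesis (stmt-3431 open). [folklore] -/
theorem kineticAbelFloor_of_kineticLimit
    (hKL : Theses.KineticCorner.KineticLimit) :
    ∀ ω₂ lam β γ : ℝ, 0 < ω₂ → 0 < lam → 0 < β → 0 < γ →
      ∃ a₀ ν₀ : ℝ, 0 < a₀ ∧ 0 < ν₀ ∧ ∀ ν : ℝ, 0 < ν → ν ≤ ν₀ →
        ∃ T₀ : ℝ, 0 < T₀ ∧ ∀ T : ℝ, 0 < T → T < T₀ →
          ∃ (μ : Measure ChainConfig) (D : InfiniteChainDynamics (pinnedChain ω₂ lam β γ)),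
            (pinnedChain ω₂ lam β γ).IsChainGibbsMeasure T μ ∧
            MeasurePreserving (fun σ : ChainConfig => fun i : ℤ => σ (i + 1)) μ μ ∧
            D.carrier = (pinnedChain ω₂ lam β γ).bmGood ∧
            D.PreservesMeasure μ ∧
            a₀ ≤ ∫ t in Ioi (0 : ℝ), Real.exp (-(ν * T ^ 2 * t)) * D.currentCorrelation μ t :=
  kineticAbelFloor_of_bmKineticLimit abelFloor_of_windowLimits
    (Theorems.DrudeDissolution.LineSketch.bmKineticLimit_of_kineticLimit hKL)

end Summit.AtomisticToContinuum.FouriersLaw.Cruxes.DrudeDissolution.NaturalScalePoissonSandwich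

end
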